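import Literature.Topology.FourManifolds.HCobordismWallConnectedSum
import Literature.Topology.FourManifolds.ConnectedSumCohomology
import Literature.Topology.FourManifolds.IntersectionLatticeOrientationIffProofs
import Literature.Topology.FourManifolds.SmoothHomologicalOrientationProofs
import Literature.Topology.FourManifolds.OrientedConnectedSumExistence
import Literature.Topology.FourManifolds.ConnectedSumProofs
import HarnessLib

/-!
# Wall's Theorem 2 along its printed proof: "Form the connected sum `N = M₁ # (−M₂)`. Since the
# signatures of `M₁` and `M₂` are equal, that of `N` is zero" — PROVED; and the algebra of
# "Since `K` is disjoint from `H₂(M₁)`, `H₂(M₂)` … the induced maps are isomorphisms"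

Topic `Literature/Topology/FourManifolds`; sibling proof file of `HCobordismWallConnectedSum.lean`
in the cone of the named fact
`Literature.Topology.FourManifolds.isHCobordant_of_equivalent_intersectionForm` (**Wall 1964,
Thm. 2**: closed smooth simply connected 4-manifolds with isometric intersection forms are
h-cobordant; C. T. C. Wall, *On simply-connected 4-manifolds*, J. London Math. Soc. 39 (1964)
141–149; `HCobordismDonaldson.lean`). The proof of Thm. 2 opens (p. 144): "Let the manifolds be
`M₁` and `M₂`. Form the connected sum `N = M₁ # (−M₂)`. Since the signatures of `M₁` and `M₂`
are equal, that of `N` is zero", and later uses "`H₂(N) ≅ H₂(M₁) ⊕ H₂(M₂)`" (p. 144) with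
intersection numbers "`xx' − yy'` … [recall (a) that we reversed the orientation of `M₂`]"
(p. 145). `HCobordismWallConnectedSum.lean` proved the algebra of these sentences GIVEN a lattice
decomposition `(sM, sN)` of `H²(N)/T` with `Q_N (x, y) = Q_{M₁} (sM x, sM y) − Q_{M₂} (sN x, sN y)`
(`signature_eq_zero_of_decomposition`, `graphSubmodule_lagrangian`,
`Cobordism.IsHCobordism.exists_homotopyEquiv_lagrangian_graph_map`); `ConnectedSumCohomology.lean`
proved that decomposition for the gluing data of an oriented connected sum
(`ConnectedSumNeck.exists_decomposition_intersectionForm`,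
`IsOrientedConnectedSum.exists_connectedSumNeck_isOriented`). This file ASSEMBLES them with the
tree's existence theorem for oriented connected sums and its dictionary between smooth and
homological orientations, so that the two sentences hold UNCONDITIONALLY under the hypotheses of
Thm. 2:

* `exists_smoothOrientation_isCompatible` — **a `ℤ`-orientation of a closed connected smooth
  manifold is the homological orientation compatible with some smooth orientation** (Bredon 1993,
  VI.7, Thm. 7.15: the tree's `isOrientable_iff_isOrientableOver_int_of_t2Space`,
  `SmoothOrientation.existsUnique_isCompatible_holds`, and Hatcher's "a connected orientable
  manifold has exactly two orientations", `HomologicalOrientation.eq_or_eq_neg_of_connected_holds`,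
  with `IsCompatible.neg` to fix the sign).
* `exists_isOrientedConnectedSum_neg_isCompatible` — **"Form the connected sum `N = M₁ # (−M₂)`"**:
  for closed smooth simply connected `n`-manifolds `M₁`, `M₂` (`3 ≤ n`) with `ℤ`-orientations `μ`,
  `ν`, there is a closed smooth simply connected `n`-manifold `N` (in `Type`, with its instances)
  and smooth orientations `o₁`, `o₂`, `oN` with `IsOrientedConnectedSum o₁ (−o₂) oN`
  (`exists_isOrientedConnectedSum_holds`; simply connected by
  `IsConnectedSum.simplyConnectedSpace_holds`) such that `μ`, `−ν` and a `ℤ`-orientation `π` of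
  `N` are compatible with `o₁`, `−o₂`, `oN`.
* `exists_connectedSum_decomposition` — **"`H₂(N) ≅ H₂(M₁) ⊕ H₂(M₂)`" with "`xx' − yy'`"**
  (n = 4): under the same hypotheses there are `N`, `π` as above and linear
  `sM : H²(N)/T → H²(M₁)/T`, `sN : H²(N)/T → H²(M₂)/T` with `x ↦ (sM x, sN x)` bijective and
  `Q⟦π⟧ x y = Q⟦μ⟧ (sM x) (sM y) − Q⟦ν⟧ (sN x) (sN y)` (the decomposition of
  `ConnectedSumCohomology.lean` for `(M₁, μ) # (M₂, −ν)`, and `Q⟦−ν⟧ = −Q⟦ν⟧`,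
  `intersectionForm_neg` with the discharged `fundamentalClass_neg_holds`); `N` is moreover a
  connected sum `M₁ # M₂` in the tree's relational sense (`IsConnectedSum (𝓡 4) (𝓡 4) (𝓡 4) M₁ M₂ N`).
* `exists_connectedSum_signature_eq_zero` — **"Since the signatures of `M₁` and `M₂` are equal,
  that of `N` is zero"**: if moreover `Q⟦μ⟧ ≅ Q⟦ν⟧` then `σ(N, π) = 0`
  (`signature_eq_zero_of_decomposition`), together with the decomposition — i.e. exactly the
  hypothesis of Wall's Thm. 1 for `N` and the inputs `hst`, `hQ` of
  `Cobordism.IsHCobordism.exists_homotopyEquiv_lagrangian_graph_map` (the graph `K`, p. 145).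
* Section `GraphQuotient` — the algebra of p. 146, **"Since `K` is disjoint from `H₂(M₁)`,
  `H₂(M₂)`, we see that the induced maps `H₂(M₁) → H₂(R)` and `H₂(M₂) → H₂(R)` are isomorphisms,
  and indeed that the composite induces the isomorphism `−α`"**: `K` is complementary to BOTH
  summands (`isCompl_graphSubmodule_ker_left`, for `α` a linear isomorphism; the complement
  `ker s` is `isCompl_graphSubmodule_ker` of `HCobordismWallConnectedSum.lean`); for a linear
  surjection `f : W → X` killing `K` (in the application `X = H₂(R)`, `f` induced by `N ⊂ R`) the
  summand inclusions composed with `f` are onto (`surjective_comp_inl_of_graphSubmodule_le_ker`,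
  `surjective_comp_inr_of_graphSubmodule_le_ker`), bijective when `ker f = K`
  (`bijective_comp_inl_of_ker_eq_graphSubmodule`, `bijective_comp_inr_of_ker_eq_graphSubmodule`),
  and `f (i₁ a) = f (i₂ (−α a))` (`comp_inl_eq_comp_inr_neg`).

Everything is proved; no named fact and no definition is introduced. What remains open under
Thm. 2 is untouched: Thm. 1 (`N` bounds a `W⁵` of the homotopy type of a bouquet of 2-spheres —
Thom's `Ω₄`, Lemma 1, Milnor's surgery; no tree statement), Lemma 2
(`exists_handlebody_isHCobordant_boundary`), [10] with [11]
(`exists_diffeomorph_freeCohomologyMap_eq_of_isometryEquiv`), and the re-gluing of §2.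

## References

* C. T. C. Wall, *On simply-connected 4-manifolds*, J. London Math. Soc. 39 (1964) 141–149, §2
  pp. 144–145. [WallJLMS1964]
* M. Kervaire, J. Milnor, *Groups of homotopy spheres I*, Ann. of Math. 77 (1963), §2.
  [KervaireMilnorAnnals1963]
* G. E. Bredon, *Topology and Geometry*, GTM 139 (1993), VI.7 Thm. 7.15. [Bredon1993]
* A. Hatcher, *Algebraic Topology*, CUP (2002), §3.3 p. 234. [HatcherAT2002]
* J. Milnor, D. Husemoller, *Symmetric bilinear forms*, Springer (1973), II §2, §V.1.
  [MilnorHusemoller1973]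
-/

open scoped Manifold ContDiff
open Function Literature.AlgebraicTopology.SingularHomology

noncomputable section

namespace Literature.Topology.FourManifolds

/-! ### From a `ℤ`-orientation to a compatible smooth orientation -/

/-- **A `ℤ`-orientation of a closed connected smooth manifold is compatible with some smooth
orientation** (Bredon 1993, VI.7, Thm. 7.15, with Hatcher 2002, p. 234 "a connected orientable
manifold has exactly two orientations"): `M` is `ℤ`-orientable, hence smoothly orientable
(`isOrientable_iff_isOrientableOver_int_of_t2Space`); a smooth orientation `o'` has a compatible
homological orientation `μ'` (`SmoothOrientation.existsUnique_isCompatible_holds`), which is `μ`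
or `−μ` (`HomologicalOrientation.eq_or_eq_neg_of_connected_holds`); in the second case `−o'` is
compatible with `μ` (`IsCompatible.neg`). Any generator convention `g`. PROVED.
[cite: Bredon1993, VI.7 Thm. 7.15] [cite: HatcherAT2002, §3.3 p. 234] -/
theorem exists_smoothOrientation_isCompatible {n : ℕ} {M : Type} [TopologicalSpace M] [T2Space M]
    [ChartedSpace (EuclideanSpace ℝ (Fin n)) M] [IsManifold (𝓡 n) ∞ M] [ConnectedSpace M]
    (g : HomologicalOrientation ℤ (EuclideanSpace ℝ (Fin n)) n) (μ : HomologicalOrientation ℤ M n) :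
    ∃ o : SmoothOrientation (𝓡 n) M, SmoothOrientation.IsCompatible g o μ := by
  obtain ⟨o'⟩ := (isOrientable_iff_isOrientableOver_int_of_t2Space (X := M) (n := n)).2 ⟨μ⟩
  obtain ⟨μ', hμ', -⟩ := SmoothOrientation.existsUnique_isCompatible_holds (n := n) (M := M) g o'
  rcases HomologicalOrientation.eq_or_eq_neg_of_connected_holds (X := M) μ' μ with h | h
  · exact ⟨o', h ▸ hμ'⟩
  · refine ⟨-o', ?_⟩
    have h2 := hμ'.neg
    rwa [h, neg_neg] at h2

/-! ### "Form the connected sum `N = M₁ # (−M₂)`" -/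

/-- **"Form the connected sum `N = M₁ # (−M₂)`"** (Wall 1964, p. 144, first sentence of the proof
of Thm. 2), with all orientations in place: for closed smooth simply connected `n`-manifolds `M₁`,
`M₂` (`3 ≤ n`; Hausdorff, second countable, compact, `C^∞` on `ℝⁿ`, in `Type`) with
`ℤ`-orientations `μ`, `ν` and any generator convention `g`, there are a closed smooth simply
connected `n`-manifold `N`, smooth orientations `o₁`, `o₂`, `oN` of `M₁`, `M₂`, `N` and a
`ℤ`-orientation `π` of `N` such that `(N, oN)` is the oriented connected sum
`(M₁, o₁) # (M₂, −o₂)` (`IsOrientedConnectedSum o₁ (−o₂) oN`: Kervaire–Milnor 1963, §2; the tree's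
`exists_isOrientedConnectedSum_holds`, simply connected by `IsConnectedSum.simplyConnectedSpace_holds`
for `n ≥ 3`) and `μ`, `−ν`, `π` are the homological orientations compatible with `o₁`, `−o₂`, `oN`
(Bredon VI.7.15). PROVED. [cite: WallJLMS1964, §2 p. 144] [cite: KervaireMilnorAnnals1963, §2 (p. 505)] [cite: Bredon1993, VI.7 Thm. 7.15] -/
theorem exists_isOrientedConnectedSum_neg_isCompatible {n : ℕ} (hn : 3 ≤ n) (M₁ M₂ : Type)
    [TopologicalSpace M₁] [T2Space M₁] [SecondCountableTopology M₁]
    [ChartedSpace (EuclideanSpace ℝ (Fin n)) M₁] [IsManifold (𝓡 n) ∞ M₁] [CompactSpace M₁]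
    [SimplyConnectedSpace M₁] [TopologicalSpace M₂] [T2Space M₂] [SecondCountableTopology M₂]
    [ChartedSpace (EuclideanSpace ℝ (Fin n)) M₂] [IsManifold (𝓡 n) ∞ M₂] [CompactSpace M₂]
    [SimplyConnectedSpace M₂] (g : HomologicalOrientation ℤ (EuclideanSpace ℝ (Fin n)) n)
    (μ : HomologicalOrientation ℤ M₁ n) (ν : HomologicalOrientation ℤ M₂ n) :
    ∃ (N : Type) (_ : TopologicalSpace N) (_ : T2Space N) (_ : SecondCountableTopology N)
      (_ : ChartedSpace (EuclideanSpace ℝ (Fin n)) N) (_ : IsManifold (𝓡 n) ∞ N) (_ : CompactSpace N)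
      (_ : SimplyConnectedSpace N) (o₁ : SmoothOrientation (𝓡 n) M₁) (o₂ : SmoothOrientation (𝓡 n) M₂)
      (oN : SmoothOrientation (𝓡 n) N) (π : HomologicalOrientation ℤ N n),
      IsOrientedConnectedSum o₁ (-o₂) oN ∧ SmoothOrientation.IsCompatible g o₁ μ ∧
        SmoothOrientation.IsCompatible g (-o₂) (-ν) ∧ SmoothOrientation.IsCompatible g oN π := by
  obtain ⟨o₁, ho₁⟩ := exists_smoothOrientation_isCompatible g μ
  obtain ⟨o₂, ho₂⟩ := exists_smoothOrientation_isCompatible g ν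
  obtain ⟨N, i1, i2, i3, i4, i5, i6, oN, hsum⟩ :=
    exists_isOrientedConnectedSum_holds (n := n) (by omega) M₁ M₂ o₁ (-o₂)
  haveI : SimplyConnectedSpace N :=
    IsConnectedSum.simplyConnectedSpace_holds (by rw [finrank_euclideanSpace_fin]; omega)
      hsum.isConnectedSum
  obtain ⟨π, hπ, -⟩ := SmoothOrientation.existsUnique_isCompatible_holds (n := n) (M := N) g oN
  exact ⟨N, i1, i2, i3, i4, i5, i6, inferInstance, o₁, o₂, oN, π, hsum, ho₁, ho₂.neg, hπ⟩

/-! ### "`H₂(N) ≅ H₂(M₁) ⊕ H₂(M₂)`", intersection numbers "`xx' − yy'`", and "that of `N` is zero" -/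

/-- **"`H₂(N) ≅ H₂(M₁) ⊕ H₂(M₂)`" with intersection numbers "`xx' − yy'`"** (Wall 1964, pp. 144–145)
for `N = M₁ # (−M₂)`, UNCONDITIONAL: for closed smooth simply connected 4-manifolds `M₁`, `M₂` with
`ℤ`-orientations `μ`, `ν` there are a closed smooth simply connected 4-manifold `N` which is a
connected sum `M₁ # M₂` (`IsConnectedSum (𝓡 4) (𝓡 4) (𝓡 4) M₁ M₂ N`), a `ℤ`-orientation `π` of
`N` and linear maps `sM : H²(N)/T → H²(M₁)/T`, `sN : H²(N)/T → H²(M₂)/T` with `x ↦ (sM x, sN x)`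
bijective and `Q⟦π⟧ x y = Q⟦μ⟧ (sM x) (sM y) − Q⟦ν⟧ (sN x) (sN y)`: the oriented sum
`(M₁, μ) # (M₂, −ν)` of `exists_isOrientedConnectedSum_neg_isCompatible`, the decomposition of
`ConnectedSumCohomology.lean` (`IsOrientedConnectedSum.exists_connectedSumNeck_isOriented`,
`ConnectedSumNeck.exists_decomposition_intersectionForm` at `k = 2`, `m = 3`) and
`Q⟦−ν⟧ = −Q⟦ν⟧` (`intersectionForm_neg`, `fundamentalClass_neg_holds`). PROVED.
[cite: WallJLMS1964, §2 pp. 144–145] [cite: MilnorHusemoller1973, §V.1] -/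
theorem exists_connectedSum_decomposition (M₁ M₂ : Type)
    [TopologicalSpace M₁] [T2Space M₁] [SecondCountableTopology M₁]
    [ChartedSpace (EuclideanSpace ℝ (Fin 4)) M₁] [IsManifold (𝓡 4) ∞ M₁] [CompactSpace M₁]
    [SimplyConnectedSpace M₁] [TopologicalSpace M₂] [T2Space M₂] [SecondCountableTopology M₂]
    [ChartedSpace (EuclideanSpace ℝ (Fin 4)) M₂] [IsManifold (𝓡 4) ∞ M₂] [CompactSpace M₂]
    [SimplyConnectedSpace M₂] (μ : HomologicalOrientation ℤ M₁ 4) (ν : HomologicalOrientation ℤ M₂ 4) :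
    ∃ (N : Type) (_ : TopologicalSpace N) (_ : T2Space N) (_ : SecondCountableTopology N)
      (_ : ChartedSpace (EuclideanSpace ℝ (Fin 4)) N) (_ : IsManifold (𝓡 4) ∞ N) (_ : CompactSpace N)
      (_ : SimplyConnectedSpace N) (π : HomologicalOrientation ℤ N 4)
      (sM : freeCohomology ℤ N 2 →ₗ[ℤ] freeCohomology ℤ M₁ 2)
      (sN : freeCohomology ℤ N 2 →ₗ[ℤ] freeCohomology ℤ M₂ 2),
      IsConnectedSum (𝓡 4) (𝓡 4) (𝓡 4) M₁ M₂ N ∧ Bijective (fun x => (sM x, sN x)) ∧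
        ∀ x y, intersectionForm two_add_two_eq_four π x y = intersectionForm two_add_two_eq_four μ (sM x) (sM y) -
          intersectionForm two_add_two_eq_four ν (sN x) (sN y) := by
  obtain ⟨N, i1, i2, i3, i4, i5, i6, i7, o₁, o₂, oN, π, hsum, h₁, h₂, hπ⟩ :=
    exists_isOrientedConnectedSum_neg_isCompatible (n := 4) (by norm_num) M₁ M₂ (HomologicalOrientationOfSmooth.μE 4) μ ν
  obtain ⟨d, hL, hR⟩ := hsum.exists_connectedSumNeck_isOriented (HomologicalOrientationOfSmooth.μE 4) h₁ h₂ hπ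
  obtain ⟨sM, sN, -, -, -, hst, hQ⟩ :=
    d.exists_decomposition_intersectionForm (m := 3) (by norm_num) (k := 2) (by norm_num)
      two_add_two_eq_four hL hR
  refine ⟨N, i1, i2, i3, i4, i5, i6, i7, π, sM, sN, hsum.isConnectedSum, hst, fun x y => ?_⟩
  refine (hQ x y).trans ?_
  show intersectionForm two_add_two_eq_four μ (sM x) (sM y) +
      intersectionForm two_add_two_eq_four (-ν) (sN x) (sN y) = _
  rw [intersectionForm_neg (HomologicalOrientation.fundamentalClass_neg_holds ℤ M₂ 4)
    two_add_two_eq_four ν, LinearMap.neg_apply, LinearMap.neg_apply, sub_eq_add_neg]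

/-- **"Form the connected sum `N = M₁ # (−M₂)`. Since the signatures of `M₁` and `M₂` are equal,
that of `N` is zero"** (Wall 1964, p. 144, the first two sentences of the proof of Thm. 2),
UNCONDITIONAL under the hypotheses of Thm. 2: for closed smooth simply connected 4-manifolds `M₁`,
`M₂` with `ℤ`-orientations `μ`, `ν` whose intersection forms are isometric, there are a closed
smooth simply connected 4-manifold `N = M₁ # M₂`, a `ℤ`-orientation `π` of `N` with
`σ(N, π) = 0` — Wall's hypothesis of his Thm. 1 for `N` — and the lattice decomposition
`(sM, sN)` of `H²(N)/T` with `Q⟦π⟧ = Q⟦μ⟧ ⊕ (−Q⟦ν⟧)`, the inputs `hst`, `hQ` of the graph-`K`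
step `Cobordism.IsHCobordism.exists_homotopyEquiv_lagrangian_graph_map` (p. 145). The signature
vanishes by `signature_eq_zero_of_decomposition` (`Q ⊥ −Q ≅ −(Q ⊥ −Q)`). PROVED.
[cite: WallJLMS1964, §2 p. 144] [cite: MilnorHusemoller1973, II §2] -/
theorem exists_connectedSum_signature_eq_zero (M₁ M₂ : Type)
    [TopologicalSpace M₁] [T2Space M₁] [SecondCountableTopology M₁]
    [ChartedSpace (EuclideanSpace ℝ (Fin 4)) M₁] [IsManifold (𝓡 4) ∞ M₁] [CompactSpace M₁]
    [SimplyConnectedSpace M₁] [TopologicalSpace M₂] [T2Space M₂] [SecondCountableTopology M₂]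
    [ChartedSpace (EuclideanSpace ℝ (Fin 4)) M₂] [IsManifold (𝓡 4) ∞ M₂] [CompactSpace M₂]
    [SimplyConnectedSpace M₂] (μ : HomologicalOrientation ℤ M₁ 4) (ν : HomologicalOrientation ℤ M₂ 4)
    (h : (intersectionForm two_add_two_eq_four μ).Equivalent (intersectionForm two_add_two_eq_four ν)) :
    ∃ (N : Type) (_ : TopologicalSpace N) (_ : T2Space N) (_ : SecondCountableTopology N)
      (_ : ChartedSpace (EuclideanSpace ℝ (Fin 4)) N) (_ : IsManifold (𝓡 4) ∞ N) (_ : CompactSpace N)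
      (_ : SimplyConnectedSpace N) (π : HomologicalOrientation ℤ N 4)
      (sM : freeCohomology ℤ N 2 →ₗ[ℤ] freeCohomology ℤ M₁ 2)
      (sN : freeCohomology ℤ N 2 →ₗ[ℤ] freeCohomology ℤ M₂ 2),
      IsConnectedSum (𝓡 4) (𝓡 4) (𝓡 4) M₁ M₂ N ∧ Bijective (fun x => (sM x, sN x)) ∧
        (∀ x y, intersectionForm two_add_two_eq_four π x y = intersectionForm two_add_two_eq_four μ (sM x) (sM y) -
          intersectionForm two_add_two_eq_four ν (sN x) (sN y)) ∧ π.signature = 0 := by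
  obtain ⟨N, i1, i2, i3, i4, i5, i6, i7, π, sM, sN, hsum, hst, hQ⟩ :=
    exists_connectedSum_decomposition M₁ M₂ μ ν
  exact ⟨N, i1, i2, i3, i4, i5, i6, i7, π, sM, sN, hsum, hst, hQ,
    signature_eq_zero_of_decomposition hst hQ h⟩

/-! ### "Since `K` is disjoint from `H₂(M₁)`, `H₂(M₂)` … the induced maps are isomorphisms … the composite induces `−α`"

The algebra of the sentence of p. 146 computing `H₂(Mᵢ) → H₂(R)`: in the decomposed lattice
`W ≅ V₁ ⊕ V₂` (`x ↦ (s x, t x)` bijective) with Wall's `K = graph α` (`graphSubmodule s t e`), for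
any linear surjection `f : W → X` killing `K` (in the application `X = H₂(R)` and `f` is induced by
`N → R`, onto with kernel `K` by Mayer–Vietoris) the summand inclusions `i₁`, `i₂` composed with
`f` are onto (bijective when `ker f = K`), and `f ∘ i₁ = f ∘ i₂ ∘ (−α)`. Arbitrary `Module ℤ`
instances (pure submodule algebra, no rank statements). -/

section GraphQuotient

variable {V₁ V₂ W X : Type*} [AddCommGroup V₁] [Module ℤ V₁] [AddCommGroup V₂] [Module ℤ V₂]
  [AddCommGroup W] [Module ℤ W] [AddCommGroup X] [Module ℤ X]
  {s : W →ₗ[ℤ] V₁} {t : W →ₗ[ℤ] V₂}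

/-- **`K` is complementary to the summand `H₂(M₁)` as well** when `α = e` is a linear
isomorphism: a graph of an isomorphism `V₁ ≅ V₂` is complementary to the first factor `ker t`
("`K` is disjoint from `H₂(M₁)`", Wall 1964, p. 146). PROVED (for `x ↦ (s x, t x)` bijective).
[cite: WallJLMS1964, §2 p. 146] -/
theorem isCompl_graphSubmodule_ker_left (hst : Bijective fun x => (s x, t x))
    (e : V₁ ≃ₗ[ℤ] V₂) : IsCompl (graphSubmodule s t (e : V₁ →ₗ[ℤ] V₂)) (LinearMap.ker t) := by
  refine IsCompl.of_eq ?_ ?_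
  · rw [Submodule.eq_bot_iff]
    rintro x ⟨hx, hx0⟩
    rw [SetLike.mem_coe, mem_graphSubmodule_iff] at hx
    rw [SetLike.mem_coe, LinearMap.mem_ker] at hx0
    have hs : s x = 0 := e.injective (by rw [map_zero]; exact hx.symm.trans hx0)
    apply hst.1
    change (s x, t x) = (s 0, t 0)
    rw [hs, hx0, map_zero, map_zero]
  · rw [Submodule.eq_top_iff']
    intro x
    obtain ⟨y, hy⟩ := hst.2 (e.symm (t x), t x)
    simp only [Prod.mk.injEq] at hy
    refine Submodule.mem_sup.2 ⟨y, ?_, x - y, ?_, add_sub_cancel y x⟩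
    · rw [mem_graphSubmodule_iff, hy.1, hy.2, LinearEquiv.coe_coe, LinearEquiv.apply_symm_apply]
    · rw [LinearMap.mem_ker, map_sub, hy.2, sub_self]

/-- **"Since `K` is disjoint from `H₂(M₂)`, the induced map `H₂(M₂) → H₂(R)` is onto"** (Wall
1964, p. 146), algebraic form: if `f : W → X` is onto with kernel containing the graph `K` of
`e : V₁ → V₂`, and `i₂ : V₂ → W` is the inclusion of the second summand (`s ∘ i₂ = 0`,
`t ∘ i₂ = id`), then `f ∘ i₂` is onto. PROVED. [cite: WallJLMS1964, §2 p. 146] -/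
theorem surjective_comp_inr_of_graphSubmodule_le_ker (hst : Bijective fun x => (s x, t x))
    (e : V₁ →ₗ[ℤ] V₂) {f : W →ₗ[ℤ] X} (hf : Surjective f)
    (hK : graphSubmodule s t e ≤ LinearMap.ker f) {i₂ : V₂ →ₗ[ℤ] W}
    (hs₂ : ∀ b, s (i₂ b) = 0) (ht₂ : ∀ b, t (i₂ b) = b) : Surjective (f ∘ₗ i₂) := by
  intro z
  obtain ⟨w, rfl⟩ := hf z
  -- decompose `w = k + w'` with `k ∈ K`, `w' ∈ ker s = range i₂`
  have hw : w ∈ graphSubmodule s t e ⊔ LinearMap.ker s := by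
    rw [(isCompl_graphSubmodule_ker hst e).sup_eq_top]; trivial
  obtain ⟨k, hk, w', hw', rfl⟩ := Submodule.mem_sup.1 hw
  refine ⟨t w', ?_⟩
  have hi : i₂ (t w') = w' := hst.1 (by
    change (s (i₂ (t w')), t (i₂ (t w'))) = (s w', t w')
    rw [hs₂, ht₂, LinearMap.mem_ker.1 hw'])
  rw [LinearMap.comp_apply, hi, map_add, LinearMap.mem_ker.1 (hK hk), zero_add]

/-- **"Since `K` is disjoint from `H₂(M₁)`, the induced map `H₂(M₁) → H₂(R)` is onto"** (Wall
1964, p. 146), algebraic form, for `α = e` onto: if `f : W → X` is onto with kernel containing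
the graph `K` of `e`, and `i₁ : V₁ → W` is the inclusion of the first summand (`s ∘ i₁ = id`,
`t ∘ i₁ = 0`), then `f ∘ i₁` is onto. PROVED. [cite: WallJLMS1964, §2 p. 146] -/
theorem surjective_comp_inl_of_graphSubmodule_le_ker (hst : Bijective fun x => (s x, t x))
    {e : V₁ →ₗ[ℤ] V₂} (he : Surjective e) {f : W →ₗ[ℤ] X} (hf : Surjective f)
    (hK : graphSubmodule s t e ≤ LinearMap.ker f) {i₁ : V₁ →ₗ[ℤ] W}
    (hs₁ : ∀ a, s (i₁ a) = a) (ht₁ : ∀ a, t (i₁ a) = 0) : Surjective (f ∘ₗ i₁) := by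
  intro z
  obtain ⟨w, rfl⟩ := hf z
  obtain ⟨a, ha⟩ := he (t w)
  -- `k := (a, e a) = (a, t w) ∈ K` and `w - k = (s w - a, 0) ∈ range i₁`
  obtain ⟨k, hk⟩ := hst.2 (a, t w)
  simp only [Prod.mk.injEq] at hk
  have hkK : k ∈ graphSubmodule s t e := by rw [mem_graphSubmodule_iff, hk.1, hk.2, ha]
  refine ⟨s w - a, ?_⟩
  have hi : i₁ (s w - a) = w - k := hst.1 (by
    change (s (i₁ (s w - a)), t (i₁ (s w - a))) = (s (w - k), t (w - k))
    rw [hs₁, ht₁, map_sub, map_sub, hk.1, hk.2, sub_self])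
  rw [LinearMap.comp_apply, hi, map_sub, LinearMap.mem_ker.1 (hK hkK), sub_zero]

/-- **"… are isomorphisms"** (Wall 1964, p. 146): if moreover `ker f = K` exactly, then `f ∘ i₂`
is a linear bijection `V₂ ≅ X`. PROVED. [cite: WallJLMS1964, §2 p. 146] -/
theorem bijective_comp_inr_of_ker_eq_graphSubmodule (hst : Bijective fun x => (s x, t x))
    (e : V₁ →ₗ[ℤ] V₂) {f : W →ₗ[ℤ] X} (hf : Surjective f)
    (hK : LinearMap.ker f = graphSubmodule s t e) {i₂ : V₂ →ₗ[ℤ] W}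
    (hs₂ : ∀ b, s (i₂ b) = 0) (ht₂ : ∀ b, t (i₂ b) = b) : Bijective (f ∘ₗ i₂) := by
  refine ⟨?_, surjective_comp_inr_of_graphSubmodule_le_ker hst e hf hK.ge hs₂ ht₂⟩
  rw [← LinearMap.ker_eq_bot, Submodule.eq_bot_iff]
  intro b hb
  rw [LinearMap.mem_ker, LinearMap.comp_apply, ← LinearMap.mem_ker, hK, mem_graphSubmodule_iff,
    hs₂, ht₂, map_zero] at hb
  exact hb

/-- **"… are isomorphisms"** (Wall 1964, p. 146): if `ker f = K` exactly and `e` is injective,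
then `f ∘ i₁` is a linear bijection `V₁ ≅ X` (for `e` onto). PROVED. [cite: WallJLMS1964, §2 p. 146] -/
theorem bijective_comp_inl_of_ker_eq_graphSubmodule (hst : Bijective fun x => (s x, t x))
    {e : V₁ →ₗ[ℤ] V₂} (he : Bijective e) {f : W →ₗ[ℤ] X} (hf : Surjective f)
    (hK : LinearMap.ker f = graphSubmodule s t e) {i₁ : V₁ →ₗ[ℤ] W}
    (hs₁ : ∀ a, s (i₁ a) = a) (ht₁ : ∀ a, t (i₁ a) = 0) : Bijective (f ∘ₗ i₁) := by
  refine ⟨?_, surjective_comp_inl_of_graphSubmodule_le_ker hst he.2 hf hK.ge hs₁ ht₁⟩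
  rw [← LinearMap.ker_eq_bot, Submodule.eq_bot_iff]
  intro a ha
  rw [LinearMap.mem_ker, LinearMap.comp_apply, ← LinearMap.mem_ker, hK, mem_graphSubmodule_iff,
    hs₁, ht₁] at ha
  exact he.1 (by rw [map_zero]; exact ha.symm)

/-- **"… and indeed the composite induces the isomorphism `−α` of `H₂(M₁)` on `H₂(M₂)`"** (Wall
1964, p. 146): in `X = W / K`, the classes of `(a, 0)` and `(0, −e a)` agree, i.e.
`f (i₁ a) = f (i₂ (−e a))`, since `(a, 0) − (0, −e a) = (a, e a) ∈ K`. PROVED.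
[cite: WallJLMS1964, §2 p. 146] -/
theorem comp_inl_eq_comp_inr_neg (e : V₁ →ₗ[ℤ] V₂) {f : W →ₗ[ℤ] X}
    (hK : graphSubmodule s t e ≤ LinearMap.ker f) {i₁ : V₁ →ₗ[ℤ] W}
    {i₂ : V₂ →ₗ[ℤ] W} (hs₁ : ∀ a, s (i₁ a) = a) (ht₁ : ∀ a, t (i₁ a) = 0)
    (hs₂ : ∀ b, s (i₂ b) = 0) (ht₂ : ∀ b, t (i₂ b) = b) (a : V₁) :
    f (i₁ a) = f (i₂ (-e a)) := by
  rw [← sub_eq_zero, ← map_sub, ← LinearMap.mem_ker]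
  refine hK ?_
  rw [mem_graphSubmodule_iff, map_sub, map_sub, hs₁, hs₂, ht₁, ht₂, sub_zero, zero_sub, neg_neg]

end GraphQuotient

end Literature.Topology.FourManifolds

end
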